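import Literature.Barriers.QuantumAdvantage.BoundedEntanglement
import Literature.Computability.QuantumComplexity.RevTableau
import Summits.QuantumAdvantage.QuantumAdvantage.Theorems.SymplecticPurityNoFreeFrameFamily
import Summits.QuantumAdvantage.QuantumAdvantage.Theorems.SymplecticPurityGoldDefs

/-!
# Route `SymplecticPurity`, crux `DeqThesis`, line `Sketch` — the final state of the two-Gold-map family

On the all-zero input of length `n ≥ 1` the two-Gold-map witness family `goldFamily` (`n + n`
ancillas) ends, after all its gates, in the normalised graph state of the Boolean map `goldMap n`
computed by its reversible part:

  `goldFamily.stateAfter 0ⁿ (size) = z ↦ [z|ancillas = goldMap n (z|inputs)] · 2^{-n/2}`.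

This is the verbatim analogue of `cubeFamily_stateAfter` (file `SymplecticPurityNoFreeFrameFamily`)
with an ancilla block of `n + n` wires: the Hadamard layer on the input wires
(`hadamards_mulVec_basisState`), the exact classical action of compiled reversible programs
(`revCompile_mulVec_basisState`, `revEval_toRevList`, `RevSim.clEval_map_finOf_apply`) and the
invariance of the input register under `goldOpsA n` (all its targets are ancilla wires).
-/

noncomputable section

set_option linter.dupNamespace false -- D-0017: single-problem summit ⇒ `QuantumAdvantage.QuantumAdvantage` by design

namespace Summit.QuantumAdvantage.QuantumAdvantage.Theorems.SymplecticPurity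

open Matrix
open Literature.Computability.QuantumComplexity Literature.Computability.Cryptography

/-! ### The input register is untouched -/

/-- Every target of the fifth-power program lies in the second value register (`≥ n + n`). -/
theorem le_target_of_mem_pentOpsA {n : ℕ} {op : ClOp ℕ} (hop : op ∈ pentOpsA n) :
    n + n ≤ op.target := by
  simp only [pentOpsA, pentLinOps, pentQuadOps, List.mem_append, List.mem_flatMap, List.mem_map,
    List.mem_range] at hop
  rcases hop with ⟨a, -, l, -, rfl⟩ | ⟨a, -, b, -, hop⟩
  · show n + n ≤ n + n + l; omega
  · split_ifs at hop
    · simp at hop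
    · rw [List.mem_map] at hop
      obtain ⟨l, -, rfl⟩ := hop
      show n + n ≤ n + n + l; omega

/-- Every target of the two-Gold-map program is an ancilla wire (`≥ n`). -/
theorem le_target_of_mem_goldOpsA {n : ℕ} {op : ClOp ℕ} (hop : op ∈ goldOpsA n) : n ≤ op.target := by
  rcases List.mem_append.1 hop with h | h
  · exact le_target_of_mem_cubeOpsA h
  · exact le_trans (Nat.le_add_right n n) (le_target_of_mem_pentOpsA h)

/-- The two-Gold-map program does not change the input register. -/
theorem clEval_goldOpsA_of_lt {n : ℕ} (w : ℕ → Bool) {i : ℕ} (hi : i < n) :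
    clEval (goldOpsA n) w i = w i :=
  clEval_apply_of_forall_target_ne _ _ fun op hop h => by
    have := le_target_of_mem_goldOpsA hop; omega

/-! ### The classical action of the transported program -/

section Fin

variable {n : ℕ} (hn : 0 < n + (n + n))

/-- On `Fin (n + (n + n))` wires: the input register is untouched. -/
theorem clEval_goldOpsFin_castAdd (w : QReg (n + (n + n))) (i : Fin n) :
    clEval (goldOpsFin n hn) w (Fin.castAdd (n + n) i) = w (Fin.castAdd (n + n) i) := by
  rw [goldOpsFin, RevSim.clEval_map_finOf_apply hn _ goldOpsA_wires, Fin.val_castAdd,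
    clEval_goldOpsA_of_lt _ i.isLt]
  exact RevSim.liftW_val w (Fin.castAdd (n + n) i)

/-- On `Fin (n + (n + n))` wires, started on `|y⟩|0^{2n}⟩`: the ancilla block ends in
`goldMap n y`. -/
theorem clEval_goldOpsFin_natAdd (y : QReg n) (j : Fin (n + n)) :
    clEval (goldOpsFin n hn) (padInput y (n + n)) (Fin.natAdd n j) = goldMap n y j := by
  rw [goldOpsFin, RevSim.clEval_map_finOf_apply hn _ goldOpsA_wires, Fin.val_natAdd]
  rfl

/-- The transported program maps `|y⟩|0^{2n}⟩` to `|y⟩|goldMap n y⟩`. -/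
theorem clEval_goldOpsFin_padInput (y : QReg n) :
    clEval (goldOpsFin n hn) (padInput y (n + n)) = Fin.append y (goldMap n y) := by
  funext p
  refine Fin.addCases (fun i => ?_) (fun j => ?_) p
  · rw [clEval_goldOpsFin_castAdd, Fin.append_left]
    show Fin.append y (fun _ => false) (Fin.castAdd (n + n) i) = y i
    rw [Fin.append_left]
  · rw [clEval_goldOpsFin_natAdd, Fin.append_right]

end Fin

/-! ### The final state -/

/-- A register label as the append of its input block and its ancilla block. -/
theorem append_blocks {n m : ℕ} (z : QReg (n + m)) :
    Fin.append (fun i => z (Fin.castAdd m i)) (fun l => z (Fin.natAdd n l)) = z :=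
  Fin.append_castAdd_natAdd

/-- **The final state of the two-Gold-map family on `0ⁿ`** (`n ≥ 1`): the normalised graph state of
`goldMap n`, i.e. amplitude `2^{-n/2}` on the labels `|y⟩|goldMap n y⟩` and `0` elsewhere
(registered sub-goal `goldFamily_stateAfter` of line `Sketch`, part (a) of `stub_goldState`). -/
theorem goldFamily_stateAfter : ∀ x : List Bool, (∀ i, x.get i = false) → 0 < x.length →
    goldFamily.stateAfter x (goldGates x.length).length =
      fun z : QReg (x.length + (x.length + x.length)) =>
        if (fun j : Fin (x.length + x.length) => z (Fin.natAdd x.length j)) =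
            goldMap x.length (fun i : Fin x.length => z (Fin.castAdd (x.length + x.length) i))
        then invSqrt2 ^ x.length else 0 := by
  intro x hx hn
  set n := x.length with hndef
  have hnn : 0 < n + (n + n) := by omega
  -- the circuit, with the `dite` resolved
  have hgates : goldGates n = (List.finRange n).map (fun i => hOn (Fin.castAdd (n + n) i)) ++
      revCompile (toRevList (goldOpsFin n hnn) (goldOpsFin_wf n hnn)) := by
    simp [goldGates, hnn]
  -- unfold `stateAfter`: all gates are applied
  show QCircuit.runOn 0 (⟨(goldGates n).take (goldGates n).length⟩ : QCircuit cliffordT (n + (n + n)))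
      (basisState (padInput x.get (n + n))) = _
  have htake : (goldGates n).take (goldGates n).length = goldGates n := List.take_length
  rw [htake, hgates, show (⟨(List.finRange n).map (fun i => hOn (Fin.castAdd (n + n) i)) ++
      revCompile (toRevList (goldOpsFin n hnn) (goldOpsFin_wf n hnn))⟩ :
        QCircuit cliffordT (n + (n + n))) =
      (⟨(List.finRange n).map (fun i => hOn (Fin.castAdd (n + n) i))⟩ :
        QCircuit cliffordT (n + (n + n))).append
        ⟨revCompile (toRevList (goldOpsFin n hnn) (goldOpsFin_wf n hnn))⟩ from rfl,
    QCircuit.runOn, QCircuit.toMatrix_append, ← Matrix.mulVec_mulVec]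
  -- the Hadamard layer
  have hws : ((List.finRange n).map (Fin.castAdd (n + n))).Nodup :=
    (List.nodup_finRange n).map (Fin.castAdd_injective n (n + n))
  have h0 : ∀ i, padInput x.get (n + n) i = false := padInput_get_eq_false x hx (n + n)
  have hH := hadamards_mulVec_basisState ((List.finRange n).map (Fin.castAdd (n + n))) hws
    (padInput x.get (n + n)) (fun i _ => h0 i)
  rw [List.map_map] at hH
  rw [show (fun i => hOn (Fin.castAdd (n + n) i)) = hOn ∘ Fin.castAdd (n + n) from rfl, hH,
    List.length_map, List.length_finRange]
  -- the reversible part, entrywise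
  funext z
  set A := QCircuit.toMatrix 0
    (⟨revCompile (toRevList (goldOpsFin n hnn) (goldOpsFin_wf n hnn))⟩ :
      QCircuit cliffordT (n + (n + n)))
    with hAdef
  set F : QReg (n + (n + n)) → QReg (n + (n + n)) := clEval (goldOpsFin n hnn) with hFdef
  -- columns of `A`: `A |z'⟩ = |F z'⟩`
  have hcol : ∀ z' : QReg (n + (n + n)), A z z' = if z = F z' then 1 else 0 := by
    intro z'
    have : A z z' = (A *ᵥ basisState z') z := by rw [mulVec_basisState]
    rw [this, hAdef, revCompile_mulVec_basisState, revEval_toRevList, basisState_apply]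
  -- the vector after the Hadamard layer, rewritten on the ancilla block
  have hanc : ∀ z' : QReg (n + (n + n)), (∀ j, j ∉ (List.finRange n).map (Fin.castAdd (n + n)) →
      z' j = padInput x.get (n + n) j) ↔ (fun l => z' (Fin.natAdd n l)) = fun _ => false := by
    intro z'
    constructor
    · intro h
      funext l
      rw [h _ (fun hm => ?_), h0]
      obtain ⟨i, -, hi⟩ := List.mem_map.1 hm
      have := congrArg Fin.val hi
      simp at this
      omega
    · intro h j hj
      rw [h0]
      induction j using Fin.addCases with
      | left i => exact absurd (List.mem_map.2 ⟨i, List.mem_finRange i, rfl⟩) hj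
      | right l => exact congrFun h l
  simp only [Matrix.mulVec, dotProduct, hcol, hanc]
  -- only `z₀ = |z.inputs⟩|0^{2n}⟩` contributes
  set y : QReg n := fun i => z (Fin.castAdd (n + n) i) with hydef
  have hFpad : F (padInput y (n + n)) = Fin.append y (goldMap n y) :=
    clEval_goldOpsFin_padInput hnn y
  rw [Finset.sum_eq_single (padInput y (n + n))]
  · -- the value at `z₀`
    have hz0 : (fun l => padInput y (n + n) (Fin.natAdd n l)) = fun _ => false := by
      funext l; exact Fin.append_right _ _ _
    rw [if_pos hz0, hFpad]
    by_cases h : (fun l => z (Fin.natAdd n l)) = goldMap n y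
    · rw [if_pos h, if_pos, one_mul]
      rw [← append_blocks z, h]
    · rw [if_neg h, if_neg, zero_mul]
      intro h'
      apply h
      funext l
      have := congrFun h' (Fin.natAdd n l)
      rwa [Fin.append_right] at this
  · -- every other `z'` contributes `0`
    intro z' _ hne
    by_cases hz' : (fun l => z' (Fin.natAdd n l)) = fun _ => false
    · rw [if_pos hz', if_neg, zero_mul]
      intro hzF
      apply hne
      have e : z' = padInput (fun i => z' (Fin.castAdd (n + n) i)) (n + n) := by
        conv_lhs => rw [← append_blocks z']
        rw [hz']; rfl
      have hy : (fun i => z' (Fin.castAdd (n + n) i)) = y := by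
        funext i
        have := congrFun hzF (Fin.castAdd (n + n) i)
        rw [e, hFdef, clEval_goldOpsFin_padInput hnn, Fin.append_left] at this
        exact this.symm
      rw [e, hy]
    · rw [if_neg hz', mul_zero]
  · exact fun h => absurd (Finset.mem_univ _) h

end Summit.QuantumAdvantage.QuantumAdvantage.Theorems.SymplecticPurity
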